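import Summits.BirchSwinnertonDyer.BirchSwinnertonDyer.Theorems.KatoDescentTamePotSupersingularTameUpperFukudaQPRecords03
import Summits.BirchSwinnertonDyer.BirchSwinnertonDyer.Theorems.KatoDescentTamePotSupersingularCartanMuRoadFukudaDoorsNoGrowth
import HarnessLib

/-!
# Route `KatoDescentTamePotSupersingular` (rung K8, sub-rung B4 (t′), cell `bsd-potss`): the KT `3Nn` FUKUDA rows of `KatoDescentTamePotSupersingularTameUpperFukudaQPRecords03`
# RE-RECORDED with Coates–Sujatha Thm. 3.4, Fukuda Thm. 1 (1)/(2) DISCHARGED and Iwasawa's growth theorem REMOVED — (A) at `(E,3)` and U₀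
# `MissingUpperBoundAt E 3` modulo Ferrero–Washington ALONE (+ `hKatoA hGZK hmod` for U₀) and ONE integer equality on the tower of `ℚ(P)`
# (seat `bsd-potss-k8t-c4` g22; `--supports stmt-BirchSwinnertonDyer-19982 --as helper`; closes nothing)

HONEST FRAMING. Route-free THEOREMS ONLY (no definition, no named fact, no `sorry`). The g19/g20 records in `KatoDescentTamePotSupersingularTameUpperFukudaQPRecords03` display the named facts
`hCS hI hFW hF1/hF2`; `fukuda1994_thm1_…_holds` (g19 p669438 / g20 p681350), `CoatesSujatha2005.thm34_…_holds` (g22 p694085) and the hI-free doors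
`CartanMuRoadFukudaDoorsNoGrowth` (g22) leave ONLY `hFW` (Ferrero–Washington, for the abelian quartic subfield of `ℚ(E[3])`): named-fact debt −2 per
theorem relative to the `…F1`/`…F2`/`…F10x` re-issues. Kernel certificates (`irr_…`, `hasModPImageEqNonsplitCartanNormalizer_…`, `addv_…`, `subTprime_…`)
are REUSED from the tree, not restated; the displayed data (Cremona's `r_an = 0`, the complex conjugation `c`, the layer equality `hord`/`hrk` certified by
kit in g19/g20) are unchanged. Per row; nothing booked; (A) / BSD proved for no curve.
[cite: Fukuda1994, Thm. 1, p. 264] [cite: CoatesSujatha2005, Thm. 3.4 (§3)] [cite: Kato2004Asterisque, Thm. 14.5 (3) (p. 236)] [cite: Washington1997, §13.3 Prop. 13.23]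
[cite: Cremona2006, Table 1]
-/

set_option autoImplicit false
set_option linter.dupNamespace false

noncomputable section

open scoped Classical NumberField
open Polynomial WeierstrassCurve NumberField Field IntermediateField
  Literature.NumberTheory.EllipticCurves Literature.NumberTheory.EllipticCurves.Rank1Residual
  Literature.NumberTheory.EllipticCurves.Rank1Residual.Typed
  Literature.NumberTheory.GaloisRepresentations Literature.NumberTheory.SerreUniformity Literature.NumberTheory.IwasawaTheory
  Summit.BirchSwinnertonDyer.Rank1Residual Summit.BirchSwinnertonDyer.Rank1Residual.Additive
  Summit.BirchSwinnertonDyer.BirchSwinnertonDyer.Theorems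

namespace Summit.BirchSwinnertonDyer.BirchSwinnertonDyer.Theorems.TameUpperUnitTwistRecords

/-- **(A) at `(207936eb1, 3)` from `ord₃ h(ℚ(P)₁) = ord₃ h(ℚ(P)₀)` on the octic `ℚ(P) = ℚ(E[3])⁺`, modulo Ferrero–Washington ALONE** (Coates–Sujatha 3.4 and Fukuda Thm. 1
discharged, no growth theorem; door `CartanMuRoadFukudaDoorsNoGrowth`; kernel certificates `irr_g207936eb1_3`, `hasModPImageEqNonsplitCartanNormalizer_g207936eb1_3` reused).
CONDITIONAL; (A) asserted for no curve. [cite: Fukuda1994, Thm. 1, p. 264] [cite: CoatesSujatha2005, Thm. 3.4 (§3)] [cite: Washington1997, §13.3 Prop. 13.23]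
[cite: Cremona2006, Table 1 (Cremona label 207936eb1)] -/
theorem conjA_g207936eb1_3_noGrowth
    (hFW : ferreroWashington1979_classicalMuVanishes)
    {W : WeierstrassCurve ℚ} [W.IsElliptic] (hWeq : W = (⟨0, 0, 0, (-9804), (-363888)⟩ : WeierstrassCurve ℚ))
    {c : absoluteGaloisGroup ℚ} (hc : IsComplexConjugation (Rat.castHom ℝ) c)
    (hord : ∀ κE : ZpExtension ↥(fixedField (Subgroup.zpowers (absRestrictNormalHom (W.divisionField 3) c))) 3,
      κE.IsCyclotomic → classNumberPExp κE (0 + 1) = classNumberPExp κE 0)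
    (κ : ZpExtension ℚ 3) (hκ : κ.IsCyclotomic) :
    ∃ (γ : absoluteGaloisGroup ℚ) (Df : W.FineSelmerDualData κ γ),
      Module.Finite ℤ_[3] (RestrictScalars ℤ_[3] (IwasawaAlgebra 3) Df.X) := by
  subst hWeq
  exact CartanMuRoadFukudaDoorsNoGrowth.conjA_three_of_hasModPImageEqNonsplitCartanNormalizer_of_realSuccEqAt _ hFW
    irr_g207936eb1_3 hasModPImageEqNonsplitCartanNormalizer_g207936eb1_3 hc 0 hord κ hκ

/-- **RECORD — UPPER half `ord₃ #Ш(E) ≤ ord₃ #Ш(E)_an` for `E = 207936eb1` at `p = 3` from `ord₃ h(ℚ(P)₁) = ord₃ h(ℚ(P)₀)`, modulo `hKatoA hGZK hmod hFW` ONLY**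
(Coates–Sujatha 3.4 and Fukuda Thm. 1 discharged, growth theorem removed; kernel certificates `irr_…`, `hasModPImageEqNonsplitCartanNormalizer_…`, `addv_…`,
`subTprime_…` reused; Cremona's `r_an = 0` displayed). Per row; nothing booked; BSD is not proved by this. [cite: Kato2004Asterisque, Thm. 14.5 (3) (p. 236)]
[cite: Fukuda1994, Thm. 1, p. 264] [cite: CoatesSujatha2005, Thm. 3.4 (§3)] [cite: Cremona2006, Table 1 (Cremona label 207936eb1)] -/
theorem missingUpperBoundAt_g207936eb1_3_noGrowth
    (hKatoA : Kato2004.rankZero_padicValNat_sha_add_padicValNat_tamagawa_le_of_additive_potGood_of_irreducible_of_fineSelmerDual_fg)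
    (hGZK : rank_eq_analyticRank_of_analyticRank_le_one) (hmod : hasEntireLFunction_rat)
    (hFW : ferreroWashington1979_classicalMuVanishes)
    {W : WeierstrassCurve ℚ} [W.IsElliptic] [W.IsGloballyMinimal] (hWeq : W = (⟨0, 0, 0, (-9804), (-363888)⟩ : WeierstrassCurve ℚ))
    (hr : W.analyticRank = 0) {c : absoluteGaloisGroup ℚ} (hc : IsComplexConjugation (Rat.castHom ℝ) c)
    (hord : ∀ κE : ZpExtension ↥(fixedField (Subgroup.zpowers (absRestrictNormalHom (W.divisionField 3) c))) 3,
      κE.IsCyclotomic → classNumberPExp κE (0 + 1) = classNumberPExp κE 0) :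
    MissingUpperBoundAt W 3 := by
  subst hWeq
  haveI : Fact (Nat.Prime 3) := ⟨Nat.prime_three⟩
  exact CartanMuRoadFukudaDoorsNoGrowth.missingUpperBoundAt_three_tame_of_hasModPImageEqNonsplitCartanNormalizer_of_realSuccEqAt _
    hKatoA hGZK hmod hFW hr addv_g207936eb1_3 subTprime_g207936eb1_3 irr_g207936eb1_3
    hasModPImageEqNonsplitCartanNormalizer_g207936eb1_3 hc 0 hord

/-- **(A) at `(207936ec1, 3)` from `ord₃ h(ℚ(P)₁) = ord₃ h(ℚ(P)₀)` on the octic `ℚ(P) = ℚ(E[3])⁺`, modulo Ferrero–Washington ALONE** (Coates–Sujatha 3.4 and Fukuda Thm. 1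
discharged, no growth theorem; door `CartanMuRoadFukudaDoorsNoGrowth`; kernel certificates `irr_g207936ec1_3`, `hasModPImageEqNonsplitCartanNormalizer_g207936ec1_3` reused).
CONDITIONAL; (A) asserted for no curve. [cite: Fukuda1994, Thm. 1, p. 264] [cite: CoatesSujatha2005, Thm. 3.4 (§3)] [cite: Washington1997, §13.3 Prop. 13.23]
[cite: Cremona2006, Table 1 (Cremona label 207936ec1)] -/
theorem conjA_g207936ec1_3_noGrowth
    (hFW : ferreroWashington1979_classicalMuVanishes)
    {W : WeierstrassCurve ℚ} [W.IsElliptic] (hWeq : W = (⟨0, 0, 0, (-3539244), 2495907792⟩ : WeierstrassCurve ℚ))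
    {c : absoluteGaloisGroup ℚ} (hc : IsComplexConjugation (Rat.castHom ℝ) c)
    (hord : ∀ κE : ZpExtension ↥(fixedField (Subgroup.zpowers (absRestrictNormalHom (W.divisionField 3) c))) 3,
      κE.IsCyclotomic → classNumberPExp κE (0 + 1) = classNumberPExp κE 0)
    (κ : ZpExtension ℚ 3) (hκ : κ.IsCyclotomic) :
    ∃ (γ : absoluteGaloisGroup ℚ) (Df : W.FineSelmerDualData κ γ),
      Module.Finite ℤ_[3] (RestrictScalars ℤ_[3] (IwasawaAlgebra 3) Df.X) := by
  subst hWeq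
  exact CartanMuRoadFukudaDoorsNoGrowth.conjA_three_of_hasModPImageEqNonsplitCartanNormalizer_of_realSuccEqAt _ hFW
    irr_g207936ec1_3 hasModPImageEqNonsplitCartanNormalizer_g207936ec1_3 hc 0 hord κ hκ

/-- **RECORD — UPPER half `ord₃ #Ш(E) ≤ ord₃ #Ш(E)_an` for `E = 207936ec1` at `p = 3` from `ord₃ h(ℚ(P)₁) = ord₃ h(ℚ(P)₀)`, modulo `hKatoA hGZK hmod hFW` ONLY**
(Coates–Sujatha 3.4 and Fukuda Thm. 1 discharged, growth theorem removed; kernel certificates `irr_…`, `hasModPImageEqNonsplitCartanNormalizer_…`, `addv_…`,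
`subTprime_…` reused; Cremona's `r_an = 0` displayed). Per row; nothing booked; BSD is not proved by this. [cite: Kato2004Asterisque, Thm. 14.5 (3) (p. 236)]
[cite: Fukuda1994, Thm. 1, p. 264] [cite: CoatesSujatha2005, Thm. 3.4 (§3)] [cite: Cremona2006, Table 1 (Cremona label 207936ec1)] -/
theorem missingUpperBoundAt_g207936ec1_3_noGrowth
    (hKatoA : Kato2004.rankZero_padicValNat_sha_add_padicValNat_tamagawa_le_of_additive_potGood_of_irreducible_of_fineSelmerDual_fg)
    (hGZK : rank_eq_analyticRank_of_analyticRank_le_one) (hmod : hasEntireLFunction_rat)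
    (hFW : ferreroWashington1979_classicalMuVanishes)
    {W : WeierstrassCurve ℚ} [W.IsElliptic] [W.IsGloballyMinimal] (hWeq : W = (⟨0, 0, 0, (-3539244), 2495907792⟩ : WeierstrassCurve ℚ))
    (hr : W.analyticRank = 0) {c : absoluteGaloisGroup ℚ} (hc : IsComplexConjugation (Rat.castHom ℝ) c)
    (hord : ∀ κE : ZpExtension ↥(fixedField (Subgroup.zpowers (absRestrictNormalHom (W.divisionField 3) c))) 3,
      κE.IsCyclotomic → classNumberPExp κE (0 + 1) = classNumberPExp κE 0) :
    MissingUpperBoundAt W 3 := by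
  subst hWeq
  haveI : Fact (Nat.Prime 3) := ⟨Nat.prime_three⟩
  exact CartanMuRoadFukudaDoorsNoGrowth.missingUpperBoundAt_three_tame_of_hasModPImageEqNonsplitCartanNormalizer_of_realSuccEqAt _
    hKatoA hGZK hmod hFW hr addv_g207936ec1_3 subTprime_g207936ec1_3 irr_g207936ec1_3
    hasModPImageEqNonsplitCartanNormalizer_g207936ec1_3 hc 0 hord

/-- **(A) at `(243360dg1, 3)` from `ord₃ h(ℚ(P)₁) = ord₃ h(ℚ(P)₀)` on the octic `ℚ(P) = ℚ(E[3])⁺`, modulo Ferrero–Washington ALONE** (Coates–Sujatha 3.4 and Fukuda Thm. 1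
discharged, no growth theorem; door `CartanMuRoadFukudaDoorsNoGrowth`; kernel certificates `irr_g243360dg1_3`, `hasModPImageEqNonsplitCartanNormalizer_g243360dg1_3` reused).
CONDITIONAL; (A) asserted for no curve. [cite: Fukuda1994, Thm. 1, p. 264] [cite: CoatesSujatha2005, Thm. 3.4 (§3)] [cite: Washington1997, §13.3 Prop. 13.23]
[cite: Cremona2006, Table 1 (Cremona label 243360dg1)] -/
theorem conjA_g243360dg1_3_noGrowth
    (hFW : ferreroWashington1979_classicalMuVanishes)
    {W : WeierstrassCurve ℚ} [W.IsElliptic] (hWeq : W = (⟨0, 0, 0, (-517736232), 4534307344944⟩ : WeierstrassCurve ℚ))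
    {c : absoluteGaloisGroup ℚ} (hc : IsComplexConjugation (Rat.castHom ℝ) c)
    (hord : ∀ κE : ZpExtension ↥(fixedField (Subgroup.zpowers (absRestrictNormalHom (W.divisionField 3) c))) 3,
      κE.IsCyclotomic → classNumberPExp κE (0 + 1) = classNumberPExp κE 0)
    (κ : ZpExtension ℚ 3) (hκ : κ.IsCyclotomic) :
    ∃ (γ : absoluteGaloisGroup ℚ) (Df : W.FineSelmerDualData κ γ),
      Module.Finite ℤ_[3] (RestrictScalars ℤ_[3] (IwasawaAlgebra 3) Df.X) := by
  subst hWeq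
  exact CartanMuRoadFukudaDoorsNoGrowth.conjA_three_of_hasModPImageEqNonsplitCartanNormalizer_of_realSuccEqAt _ hFW
    irr_g243360dg1_3 hasModPImageEqNonsplitCartanNormalizer_g243360dg1_3 hc 0 hord κ hκ

/-- **RECORD — UPPER half `ord₃ #Ш(E) ≤ ord₃ #Ш(E)_an` for `E = 243360dg1` at `p = 3` from `ord₃ h(ℚ(P)₁) = ord₃ h(ℚ(P)₀)`, modulo `hKatoA hGZK hmod hFW` ONLY**
(Coates–Sujatha 3.4 and Fukuda Thm. 1 discharged, growth theorem removed; kernel certificates `irr_…`, `hasModPImageEqNonsplitCartanNormalizer_…`, `addv_…`,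
`subTprime_…` reused; Cremona's `r_an = 0` displayed). Per row; nothing booked; BSD is not proved by this. [cite: Kato2004Asterisque, Thm. 14.5 (3) (p. 236)]
[cite: Fukuda1994, Thm. 1, p. 264] [cite: CoatesSujatha2005, Thm. 3.4 (§3)] [cite: Cremona2006, Table 1 (Cremona label 243360dg1)] -/
theorem missingUpperBoundAt_g243360dg1_3_noGrowth
    (hKatoA : Kato2004.rankZero_padicValNat_sha_add_padicValNat_tamagawa_le_of_additive_potGood_of_irreducible_of_fineSelmerDual_fg)
    (hGZK : rank_eq_analyticRank_of_analyticRank_le_one) (hmod : hasEntireLFunction_rat)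
    (hFW : ferreroWashington1979_classicalMuVanishes)
    {W : WeierstrassCurve ℚ} [W.IsElliptic] [W.IsGloballyMinimal] (hWeq : W = (⟨0, 0, 0, (-517736232), 4534307344944⟩ : WeierstrassCurve ℚ))
    (hr : W.analyticRank = 0) {c : absoluteGaloisGroup ℚ} (hc : IsComplexConjugation (Rat.castHom ℝ) c)
    (hord : ∀ κE : ZpExtension ↥(fixedField (Subgroup.zpowers (absRestrictNormalHom (W.divisionField 3) c))) 3,
      κE.IsCyclotomic → classNumberPExp κE (0 + 1) = classNumberPExp κE 0) :
    MissingUpperBoundAt W 3 := by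
  subst hWeq
  haveI : Fact (Nat.Prime 3) := ⟨Nat.prime_three⟩
  exact CartanMuRoadFukudaDoorsNoGrowth.missingUpperBoundAt_three_tame_of_hasModPImageEqNonsplitCartanNormalizer_of_realSuccEqAt _
    hKatoA hGZK hmod hFW hr addv_g243360dg1_3 subTprime_g243360dg1_3 irr_g243360dg1_3
    hasModPImageEqNonsplitCartanNormalizer_g243360dg1_3 hc 0 hord

/-- **(A) at `(243360l1, 3)` from `ord₃ h(ℚ(P)₁) = ord₃ h(ℚ(P)₀)` on the octic `ℚ(P) = ℚ(E[3])⁺`, modulo Ferrero–Washington ALONE** (Coates–Sujatha 3.4 and Fukuda Thm. 1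
discharged, no growth theorem; door `CartanMuRoadFukudaDoorsNoGrowth`; kernel certificates `irr_g243360l1_3`, `hasModPImageEqNonsplitCartanNormalizer_g243360l1_3` reused).
CONDITIONAL; (A) asserted for no curve. [cite: Fukuda1994, Thm. 1, p. 264] [cite: CoatesSujatha2005, Thm. 3.4 (§3)] [cite: Washington1997, §13.3 Prop. 13.23]
[cite: Cremona2006, Table 1 (Cremona label 243360l1)] -/
theorem conjA_g243360l1_3_noGrowth
    (hFW : ferreroWashington1979_classicalMuVanishes)
    {W : WeierstrassCurve ℚ} [W.IsElliptic] (hWeq : W = (⟨0, 0, 0, (-57526248), (-167937309072)⟩ : WeierstrassCurve ℚ))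
    {c : absoluteGaloisGroup ℚ} (hc : IsComplexConjugation (Rat.castHom ℝ) c)
    (hord : ∀ κE : ZpExtension ↥(fixedField (Subgroup.zpowers (absRestrictNormalHom (W.divisionField 3) c))) 3,
      κE.IsCyclotomic → classNumberPExp κE (0 + 1) = classNumberPExp κE 0)
    (κ : ZpExtension ℚ 3) (hκ : κ.IsCyclotomic) :
    ∃ (γ : absoluteGaloisGroup ℚ) (Df : W.FineSelmerDualData κ γ),
      Module.Finite ℤ_[3] (RestrictScalars ℤ_[3] (IwasawaAlgebra 3) Df.X) := by
  subst hWeq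
  exact CartanMuRoadFukudaDoorsNoGrowth.conjA_three_of_hasModPImageEqNonsplitCartanNormalizer_of_realSuccEqAt _ hFW
    irr_g243360l1_3 hasModPImageEqNonsplitCartanNormalizer_g243360l1_3 hc 0 hord κ hκ

/-- **RECORD — UPPER half `ord₃ #Ш(E) ≤ ord₃ #Ш(E)_an` for `E = 243360l1` at `p = 3` from `ord₃ h(ℚ(P)₁) = ord₃ h(ℚ(P)₀)`, modulo `hKatoA hGZK hmod hFW` ONLY**
(Coates–Sujatha 3.4 and Fukuda Thm. 1 discharged, growth theorem removed; kernel certificates `irr_…`, `hasModPImageEqNonsplitCartanNormalizer_…`, `addv_…`,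
`subTprime_…` reused; Cremona's `r_an = 0` displayed). Per row; nothing booked; BSD is not proved by this. [cite: Kato2004Asterisque, Thm. 14.5 (3) (p. 236)]
[cite: Fukuda1994, Thm. 1, p. 264] [cite: CoatesSujatha2005, Thm. 3.4 (§3)] [cite: Cremona2006, Table 1 (Cremona label 243360l1)] -/
theorem missingUpperBoundAt_g243360l1_3_noGrowth
    (hKatoA : Kato2004.rankZero_padicValNat_sha_add_padicValNat_tamagawa_le_of_additive_potGood_of_irreducible_of_fineSelmerDual_fg)
    (hGZK : rank_eq_analyticRank_of_analyticRank_le_one) (hmod : hasEntireLFunction_rat)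
    (hFW : ferreroWashington1979_classicalMuVanishes)
    {W : WeierstrassCurve ℚ} [W.IsElliptic] [W.IsGloballyMinimal] (hWeq : W = (⟨0, 0, 0, (-57526248), (-167937309072)⟩ : WeierstrassCurve ℚ))
    (hr : W.analyticRank = 0) {c : absoluteGaloisGroup ℚ} (hc : IsComplexConjugation (Rat.castHom ℝ) c)
    (hord : ∀ κE : ZpExtension ↥(fixedField (Subgroup.zpowers (absRestrictNormalHom (W.divisionField 3) c))) 3,
      κE.IsCyclotomic → classNumberPExp κE (0 + 1) = classNumberPExp κE 0) :
    MissingUpperBoundAt W 3 := by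
  subst hWeq
  haveI : Fact (Nat.Prime 3) := ⟨Nat.prime_three⟩
  exact CartanMuRoadFukudaDoorsNoGrowth.missingUpperBoundAt_three_tame_of_hasModPImageEqNonsplitCartanNormalizer_of_realSuccEqAt _
    hKatoA hGZK hmod hFW hr addv_g243360l1_3 subTprime_g243360l1_3 irr_g243360l1_3
    hasModPImageEqNonsplitCartanNormalizer_g243360l1_3 hc 0 hord

end Summit.BirchSwinnertonDyer.BirchSwinnertonDyer.Theorems.TameUpperUnitTwistRecords

end
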